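import Literature.AnabelianGeometry.AbsoluteAnabelian.LocalResidueMapRestrictionIndex
import Literature.NumberTheory.GaloisRepresentations.CorNaturality
import Literature.NumberTheory.GaloisRepresentations.LocalWeilDatumExtensionGalois
import Literature.AnabelianGeometry.AbsoluteAnabelian.MLFReciprocityEquivariantProofs
import HarnessLib

/-!
# The residue map under corestriction: `inv_F ∘ Cor_{E/F} = inv_E`

abc-iut cell, layer L4 (L4-lead RULING #5r (7) «O1», seat abc-iut-w5-d201; sequel of
`LocalResidueMapRestriction(Index).lean`, sub-DAG `plan/L4/SUBDAG-AbsTopIII-Prop32.md` row P32.i.L07-model).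
J.-P. Serre, *Local Fields* (1979): XIII §3 Prop. 7 — for a finite extension `E/F` of non-archimedean
local fields, `inv_E ∘ Res = [E : F] · inv_F` (`invariantQZEquiv_res`) — **and XI §2 Prop. 1 (ii) —
`Cor_{E/F}` is injective and `inv_F ∘ Cor = inv_E`** (stated for any class formation; the local fields form
one by XIII §4), this file, proved exactly as on p. 167 there (from `inv ∘ Res = [E:F] · inv`, `Cor ∘ Res =
[E : F]` and the divisibility of `ℚ/ℤ`); with *Cohomologie galoisienne* I §2.4 Prop. 9 (`Cor ∘ Res = (G : S)`)
— the pair of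
identities behind [NSW] (7.1.4) «induced on subquotients» cited by [FrdII] Thm 2.4 (ii) p. 21 and behind
[AbsTopIII] Rmk. 3.2.2 / Rmk. 1.10.1 (iii).

For fields `F`, `E` with `[Algebra F E]` algebraic (later: MLFs of characteristic `0`, `E/F` finite, each with
its own local structure), `E₀ = ι⁻¹(E) ⊆ F̄` (`embField`, `ι = absClosureEmbedding F E`), `S = Gal(F̄/E₀) ≤ Γ_F`
(`galFixing F (embField F E)`):

* `liftGalC F E : S →ₜ* Γ_E` — the lift (inverse of `res : Γ_E ⥲ S`, `liftGalHom`; continuity from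
  `exists_continuousMulEquiv_galFixing_embField`); `muResInv : μ_n(Ē) →+ μ_n(F̄)` (`ι⁻¹`), `S`-equivariant over
  the lift (`muResInv_smul`); `pullLift F E n q : H^q(Γ_E, μ_n(Ē)) →+ H^q(S, μ_n(F̄)|_S)` (Mathlib
  `ContinuousCohomology.map` along `(liftGalC, ι⁻¹)`), with **`pullLift_resMu : pullLift ∘ Res = res_S`**
  (the trunk's subgroup restriction `resH`) and `pullLift_cohomologyMap_muInclHom`;
* **`corMu F E n : H²(Γ_E, μ_n(Ē)) →+ H²(Γ_F, μ_n(F̄))`** := the trunk's corestriction `cor S` (Shapiro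
  extension + norm, `Corestriction.lean`) ∘ `pullLift`; **`corMu_resMu : Cor (Res x) = [E : F] • x`**
  (`cor_resH`, `index_galFixing_embField : (Γ_F : S) = [E : F]`); `corMu_cohomologyMap_muInclHom`
  (naturality in `μ_n ⊆ μ_N`, `cor_cohomologyMap`);
* **`H2MuQZ.cor : H²(Γ_E, μ_{ℚ/ℤ}) →+ H²(Γ_F, μ_{ℚ/ℤ})`** on the colimits, `H2MuQZ.cor_of`, `H2MuQZ.cor_res`;
* **`invariantQZEquiv_cor : invariantQZEquiv F (Cor y) = invariantQZEquiv E y`** and, at level `n`,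
  **`invLevel_corMu : invLevel F n (corMu F E n y) = invLevel E n y`** — Serre's argument: `ℚ/ℤ` is
  divisible, so every class of `E` is a restriction (`invariantQZEquiv_res` is onto multiples of `[E:F]`),
  and `Cor ∘ Res = [E : F]`; the finite level follows by the injectivity of `ℤ/n ↪ ℚ/ℤ`.

Constructions + proofs over the tree's real objects; no named fact; HONEST FRAMING: classical local class
field theory; nothing here bears on [IUTchIII] Cor. 3.12 or takes a side.
-/

noncomputable section

universe u

namespace Literature.AnabelianGeometry.AbsoluteAnabelian

open Field Function IntermediateField CategoryTheory
open Literature.NumberTheory.GaloisRepresentations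
open Literature.NumberTheory.GaloisRepresentations.DiscreteGaloisModule
open Literature.NumberTheory.GaloisRepresentations.LocalWeilDatum
open Literature.NumberTheory.GaloisRepresentations.IsNonarchimedeanLocalField
open ValuativeRel

namespace Prop121vii

/-! ### §1. `Γ_E ≅ Gal(F̄/E₀) ≤ Γ_F` and the comparison `H^q(Γ_E, μ_n(Ē)) → H^q(Gal(F̄/E₀), μ_n(F̄)|)` -/

section Lift

variable (F E : Type u) [Field F] [Field E] [Algebra F E] [Algebra.IsAlgebraic F E] (n : ℕ)

/-- The lift `Gal(F̄/E₀) → Γ_E` (`E₀ = ι⁻¹(E)`, inverse of the restriction `res : Γ_E ⥲ Gal(F̄/E₀)`) as a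
CONTINUOUS homomorphism. [cite: TateCorvallis1979, §1.4 (1.4.5)] -/
def liftGalC : galFixing F (embField F E) →ₜ* absoluteGaloisGroup E where
  toMonoidHom := liftGalHom F E
  continuous_toFun := by
    obtain ⟨Φ, hΦ⟩ := exists_continuousMulEquiv_galFixing_embField F E
    have h : ((liftGalHom F E : galFixing F (embField F E) →* absoluteGaloisGroup E) :
        galFixing F (embField F E) → absoluteGaloisGroup E) = Φ :=
      funext fun g => (liftGalHom_apply F E g).trans (hΦ g).symm
    change Continuous ((liftGalHom F E : galFixing F (embField F E) →* absoluteGaloisGroup E) :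
        galFixing F (embField F E) → absoluteGaloisGroup E)
    rw [h]
    exact Φ.continuous

/-- `liftGalC g = liftGal g`. [cite: TateCorvallis1979, §1.4 (1.4.5)] -/
@[simp] theorem liftGalC_apply (g : galFixing F (embField F E)) : liftGalC F E g = liftGal F E g.2 := rfl

/-- `res (liftGalC g) = g`. [cite: TateCorvallis1979, §1.4 (1.4.5)] -/
@[simp] theorem absGaloisRestrict_liftGalC (g : galFixing F (embField F E)) :
    absGaloisRestrict F E (liftGalC F E g) = g :=
  absGaloisRestrict_liftGal F E g.2

/-- `μ_n(Ē) → μ_n(F̄)` along `ι⁻¹` (`ι = absClosureEmbedding F E`, bijective for `E/F` algebraic).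
[cite: SerreGaloisCohomology1997, I §2.4] -/
def muResInv : MuCarrier E n →+ MuCarrier F n where
  toFun v := muOfUnit F n (Units.map ((absClosureEquiv F E).symm : AlgebraicClosure E →* AlgebraicClosure F)
      (muVal E n v)) (by rw [← map_pow, muVal_pow_eq_one, map_one])
  map_zero' := muVal_injective F n (by rw [muVal_muOfUnit, muVal_zero, muVal_zero, map_one])
  map_add' v w := muVal_injective F n (by
    rw [muVal_muOfUnit, muVal_add, muVal_add, muVal_muOfUnit, muVal_muOfUnit, map_mul])

/-- `muRes (muResInv v) = v`. [cite: SerreGaloisCohomology1997, I §2.4] -/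
@[simp] theorem muRes_muResInv (v : MuCarrier E n) : muRes F E n (muResInv F E n v) = v := by
  apply muVal_injective E n
  refine Units.ext ?_
  rw [coe_muVal_muRes]
  change absClosureEmbedding F E ((absClosureEquiv F E).symm ((muVal E n v : (AlgebraicClosure E)ˣ) :
    AlgebraicClosure E)) = _
  rw [absClosureEmbedding_absClosureEquiv_symm]

/-- `muResInv (muRes v) = v`. [cite: SerreGaloisCohomology1997, I §2.4] -/
@[simp] theorem muResInv_muRes (v : MuCarrier F n) : muResInv F E n (muRes F E n v) = v := by
  apply muVal_injective F n
  refine Units.ext ?_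
  change (absClosureEquiv F E).symm (((muVal E n (muRes F E n v) : (AlgebraicClosure E)ˣ) :
    AlgebraicClosure E)) = _
  rw [coe_muVal_muRes, absClosureEquiv_symm_absClosureEmbedding]

/-- `muRes` is injective. [cite: SerreGaloisCohomology1997, I §2.4] -/
theorem muRes_injective : Injective (muRes F E n) :=
  fun v w h => by rw [← muResInv_muRes F E n v, h, muResInv_muRes]

/-- **Equivariance of `ι⁻¹|μ_n` over the lift**: `muResInv (liftGal g · y) = g · muResInv y`.
[cite: SerreGaloisCohomology1997, I §2.4] -/
theorem muResInv_smul (g : galFixing F (embField F E)) (y : MuCarrier E n) :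
    muResInv F E n (mu E n (liftGalC F E g) y) = mu F n (g : absoluteGaloisGroup F) (muResInv F E n y) := by
  apply muRes_injective F E n
  conv_rhs => rw [← absGaloisRestrict_liftGalC F E g]
  rw [muRes_muResInv, muRes_smul, muRes_muResInv]

/-- The coefficient morphism `μ_n(Ē)|_{Gal(F̄/E₀)} → μ_n(F̄)|_{Gal(F̄/E₀)}` over the lift.
[cite: SerreGaloisCohomology1997, I §2.4] -/
def liftCoeff :
    TopRep.res (liftGalC F E : galFixing F (embField F E) →* absoluteGaloisGroup E) (mu E n).toTopRep ⟶
      ((mu F n).restrict (subgroupIncl (galFixing F (embField F E)))).toTopRep :=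
  TopRep.ofHom ⟨⟨(muResInv F E n).toIntLinearMap, continuous_of_discreteTopology⟩, fun g => by
    refine ContinuousLinearMap.ext fun y => ?_
    exact muResInv_smul F E n g y⟩

/-- `liftCoeff` on elements is `muResInv`. [cite: SerreGaloisCohomology1997, I §2.4] -/
@[simp] theorem liftCoeff_hom_apply (y : MuCarrier E n) : (liftCoeff F E n).hom y = muResInv F E n y := rfl

/-- **`H^q(Γ_E, μ_n(Ē)) → H^q(Gal(F̄/E₀), μ_n(F̄)|)`**, the pull-back along the lift
`Gal(F̄/E₀) ⥲ Γ_E` with coefficients `ι⁻¹` (identifies the abstract layer `E` with the subgroup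
layer `Gal(F̄/E₀) ≤ Γ_F` of the trunk). [cite: SerreGaloisCohomology1997, I §2.4] -/
def pullLift (q : ℕ) : galoisCohomology (mu E n) q →+
    continuousCohomology q ((mu F n).restrict (subgroupIncl (galFixing F (embField F E)))).toTopRep :=
  (ContinuousCohomology.map (liftGalC F E) (liftCoeff F E n) q).hom.toLinearMap.toAddMonoidHom

/-- `pullLift` is Mathlib's `ContinuousCohomology.map` on elements. [cite: SerreGaloisCohomology1997, I §2.4] -/
theorem pullLift_apply (q : ℕ) (y : galoisCohomology (mu E n) q) :
    pullLift F E n q y = ContinuousCohomology.map (liftGalC F E) (liftCoeff F E n) q y := rfl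

/-- **`pullLift ∘ Res = res_{Gal(F̄/E₀)}`**: restricting to `Γ_E` and transporting to the subgroup
layer is the trunk's subgroup restriction `resH`. [cite: SerreGaloisCohomology1997, I §2.4] -/
theorem pullLift_resMu (x : galoisCohomology (mu F n) 2) :
    haveI : CompactSpace (absoluteGaloisGroup F) := absoluteGaloisGroup_compactSpace F
    pullLift F E n 2 (resMu F E n 2 x) = resH (galFixing F (embField F E)) (mu F n) 2 x := by
  haveI : CompactSpace (absoluteGaloisGroup F) := absoluteGaloisGroup_compactSpace F
  haveI : CompactSpace (absoluteGaloisGroup E) := absoluteGaloisGroup_compactSpace E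
  haveI : IsClosed ((galFixing F (embField F E) : Subgroup (absoluteGaloisGroup F)) :
      Set (absoluteGaloisGroup F)) := isClosed_galFixing F (embField F E)
  obtain ⟨c, rfl⟩ := twoCocycleClass_surjective _ x
  rw [resMu_apply, map_twoCocycleClass, pullLift_apply, map_twoCocycleClass, resH_twoCocycleClass]
  refine congrArg (twoCocycleClass _) (Subtype.ext (ContinuousMap.ext fun p => ?_))
  obtain ⟨g, g'⟩ := p
  rw [contTwoCocycles.pullback_apply, contTwoCocycles.pullback_apply, contTwoCocycles.pullback_apply,
    liftCoeff_hom_apply, resCoeff_hom_apply, absGaloisRestrict_liftGalC, absGaloisRestrict_liftGalC,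
    muResInv_muRes]
  rfl

end Lift

/-! ### §2. The corestriction `Cor : H²(Γ_E, μ_n(Ē)) → H²(Γ_F, μ_n(F̄))` and `Cor ∘ Res = [E : F]` -/

section Cor

variable (F E : Type u) [Field F] [CharZero F] [Field E] [Algebra F E] [FiniteDimensional F E] (n : ℕ)

/-- `(Γ_F : Gal(F̄/E₀)) = [E : F]` (characteristic `0`, so that `F̄/F` is Galois).
[cite: SerreGaloisCohomology1997, I §2.4] -/
theorem index_galFixing_embField :
    (galFixing F (embField F E)).index = Module.finrank F E := by
  haveI := finiteDimensional_embField F E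
  have h1 : (galFixing F (embField F E)).index = (embField F E).fixingSubgroup.index :=
    Subgroup.index_comap_of_surjective _ fun x =>
      ⟨(absoluteGaloisGroup.toAlgEquiv F).symm x, (absoluteGaloisGroup.toAlgEquiv F).apply_symm_apply x⟩
  rw [h1, ← IntermediateField.finrank_eq_fixingSubgroup_index]
  exact (equivEmbField F E).toLinearEquiv.finrank_eq.symm

omit [CharZero F] [FiniteDimensional F E] in
/-- `muVal (muResInv v) = ι⁻¹ (muVal v)`. [cite: SerreGaloisCohomology1997, I §2.4] -/
@[simp] theorem muVal_muResInv [Algebra.IsAlgebraic F E] (v : MuCarrier E n) :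
    muVal F n (muResInv F E n v) =
      Units.map ((absClosureEquiv F E).symm : AlgebraicClosure E →* AlgebraicClosure F) (muVal E n v) := rfl

/-- **The corestriction `Cor_{E/F} : H²(Γ_E, μ_n(Ē)) →+ H²(Γ_F, μ_n(F̄))`**: the trunk's corestriction
`cor` along the open subgroup `Gal(F̄/E₀) ≤ Γ_F` (Shapiro extension followed by the norm,
`Corestriction.lean`) precomposed with the identification `pullLift` of the abstract layer `E` with the
subgroup layer. [cite: SerreGaloisCohomology1997, I §2.5] -/
def corMu : galoisCohomology (mu E n) 2 →+ galoisCohomology (mu F n) 2 :=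
  haveI : CompactSpace (absoluteGaloisGroup F) := absoluteGaloisGroup_compactSpace F
  haveI : IsClosed ((galFixing F (embField F E) : Subgroup (absoluteGaloisGroup F)) :
      Set (absoluteGaloisGroup F)) := isClosed_galFixing F (embField F E)
  haveI := finiteDimensional_embField F E
  haveI : Finite (absoluteGaloisGroup F ⧸ galFixing F (embField F E)) := finite_quot_galFixing F (embField F E)
  haveI : Fintype (absoluteGaloisGroup F ⧸ galFixing F (embField F E)) := Fintype.ofFinite _
  (cor (galFixing F (embField F E)) (mu F n) 2).hom.toLinearMap.toAddMonoidHom.comp (pullLift F E n 2)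

/-- **`Cor ∘ Res = [E : F]`** on `H²(Γ_F, μ_n(F̄))` (Serre, *Cohomologie galoisienne* I §2.4 Prop. 9,
through the trunk's `cor_resH` and `pullLift_resMu`). [cite: SerreGaloisCohomology1997, I §2.4 Prop. 9] -/
theorem corMu_resMu (x : galoisCohomology (mu F n) 2) :
    corMu F E n (resMu F E n 2 x) = Module.finrank F E • x := by
  haveI : CompactSpace (absoluteGaloisGroup F) := absoluteGaloisGroup_compactSpace F
  haveI : IsClosed ((galFixing F (embField F E) : Subgroup (absoluteGaloisGroup F)) :
      Set (absoluteGaloisGroup F)) := isClosed_galFixing F (embField F E)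
  haveI := finiteDimensional_embField F E
  haveI : Finite (absoluteGaloisGroup F ⧸ galFixing F (embField F E)) := finite_quot_galFixing F (embField F E)
  letI : Fintype (absoluteGaloisGroup F ⧸ galFixing F (embField F E)) := Fintype.ofFinite _
  rw [← index_galFixing_embField F E]
  change cor (galFixing F (embField F E)) (mu F n) 2 (pullLift F E n 2 (resMu F E n 2 x)) = _
  rw [pullLift_resMu]
  exact cor_resH (galFixing F (embField F E)) (mu F n) 1 x

omit [CharZero F] [FiniteDimensional F E] in
/-- `pullLift` commutes with `μ_n ⊆ μ_N`. [cite: SerreGaloisCohomology1997, I §2.4] -/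
theorem pullLift_cohomologyMap_muInclHom [Algebra.IsAlgebraic F E] {n N : ℕ} (h : n ∣ N)
    (y : galoisCohomology (mu E n) 2) :
    haveI : CompactSpace (absoluteGaloisGroup F) := absoluteGaloisGroup_compactSpace F
    haveI : CompactSpace (absoluteGaloisGroup E) := absoluteGaloisGroup_compactSpace E
    pullLift F E N 2 (cohomologyMap (muInclHom E h) 2 y) =
      cohomologyMap (resModHom (galFixing F (embField F E)) (muInclHom F h)) 2 (pullLift F E n 2 y) := by
  haveI : CompactSpace (absoluteGaloisGroup F) := absoluteGaloisGroup_compactSpace F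
  haveI : CompactSpace (absoluteGaloisGroup E) := absoluteGaloisGroup_compactSpace E
  haveI : IsClosed ((galFixing F (embField F E) : Subgroup (absoluteGaloisGroup F)) :
      Set (absoluteGaloisGroup F)) := isClosed_galFixing F (embField F E)
  obtain ⟨c, rfl⟩ := twoCocycleClass_surjective _ y
  rw [pullLift_apply, pullLift_apply, map_twoCocycleClass, map_twoCocycleClass, map_twoCocycleClass,
    map_twoCocycleClass]
  refine congrArg (twoCocycleClass _) (Subtype.ext (ContinuousMap.ext fun p => ?_))
  obtain ⟨g, g'⟩ := p
  rw [contTwoCocycles.pullback_apply, contTwoCocycles.pullback_apply, contTwoCocycles.pullback_apply,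
    contTwoCocycles.pullback_apply, liftCoeff_hom_apply, liftCoeff_hom_apply, resIdHom_hom_apply,
    resIdHom_hom_apply, muInclHom_hom_apply, resModHom_hom_apply, muInclHom_hom_apply]
  apply muVal_injective F N
  rw [muVal_muResInv, muVal_muInclusion, muVal_muInclusion, muVal_muResInv]
  rfl

/-- **`Cor` commutes with `μ_n ⊆ μ_N`** (naturality of the corestriction in the coefficients,
`cor_cohomologyMap`). [cite: SerreGaloisCohomology1997, I §2.5] -/
theorem corMu_cohomologyMap_muInclHom {n N : ℕ} (h : n ∣ N) (y : galoisCohomology (mu E n) 2) :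
    haveI : CompactSpace (absoluteGaloisGroup F) := absoluteGaloisGroup_compactSpace F
    haveI : CompactSpace (absoluteGaloisGroup E) := absoluteGaloisGroup_compactSpace E
    corMu F E N (cohomologyMap (muInclHom E h) 2 y) = cohomologyMap (muInclHom F h) 2 (corMu F E n y) := by
  haveI : CompactSpace (absoluteGaloisGroup F) := absoluteGaloisGroup_compactSpace F
  haveI : CompactSpace (absoluteGaloisGroup E) := absoluteGaloisGroup_compactSpace E
  haveI : IsClosed ((galFixing F (embField F E) : Subgroup (absoluteGaloisGroup F)) :
      Set (absoluteGaloisGroup F)) := isClosed_galFixing F (embField F E)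
  haveI := finiteDimensional_embField F E
  haveI : Finite (absoluteGaloisGroup F ⧸ galFixing F (embField F E)) := finite_quot_galFixing F (embField F E)
  letI : Fintype (absoluteGaloisGroup F ⧸ galFixing F (embField F E)) := Fintype.ofFinite _
  change cor (galFixing F (embField F E)) (mu F N) 2 (pullLift F E N 2 (cohomologyMap (muInclHom E h) 2 y)) =
    cohomologyMap (muInclHom F h) 2 (cor (galFixing F (embField F E)) (mu F n) 2 (pullLift F E n 2 y))
  rw [pullLift_cohomologyMap_muInclHom]
  exact cor_cohomologyMap (galFixing F (embField F E)) (mu F n) (mu F N) (muInclHom F h) 1 _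

/-- **`Cor : H²(Γ_E, μ_{ℚ/ℤ}(Ē)) → H²(Γ_F, μ_{ℚ/ℤ}(F̄))`** on the colimits `colim_n H²(·, μ_n)`.
[cite: SerreLocalFields1979, XI §2 Prop. 1 (ii)] -/
def H2MuQZ.cor : H2MuQZ E →+ H2MuQZ F :=
  AddCommGroup.DirectLimit.lift (fun m : DivLevel => galoisCohomology (mu E (m.val : ℕ)) 2) (H2MuSystem E)
    (H2MuQZ F) (fun m => (H2MuQZ.of m.val).comp (corMu F E (m.val : ℕ)))
    (fun i j hij x => by
      rw [AddMonoidHom.comp_apply, AddMonoidHom.comp_apply, H2MuSystem_apply,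
        corMu_cohomologyMap_muInclHom]
      exact H2MuQZ.of_cohomologyMap (DivLevel.le_iff.1 hij) _)

/-- `Cor` on a level-`n` class is the levelwise `Cor`. [cite: SerreLocalFields1979, XI §2 Prop. 1 (ii)] -/
theorem H2MuQZ.cor_of (n : ℕ+) (y : galoisCohomology (mu E (n : ℕ)) 2) :
    H2MuQZ.cor F E (H2MuQZ.of n y) = H2MuQZ.of n (corMu F E (n : ℕ) y) :=
  AddCommGroup.DirectLimit.lift_of (G := fun m : DivLevel => galoisCohomology (mu E (m.val : ℕ)) 2)
    (f := H2MuSystem E) _ _ _ (DivLevel.ofPNat n) y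

/-- **`Cor ∘ Res = [E : F]` on `H²(·, μ_{ℚ/ℤ})`.** [cite: SerreGaloisCohomology1997, I §2.4 Prop. 9] -/
theorem H2MuQZ.cor_res (x : H2MuQZ F) :
    H2MuQZ.cor F E (H2MuQZ.res F E x) = Module.finrank F E • x := by
  obtain ⟨n, x, rfl⟩ := H2MuQZ.exists_of x
  rw [H2MuQZ.res_of, H2MuQZ.cor_of, corMu_resMu, map_nsmul]

end Cor

/-! ### §3. `inv_F ∘ Cor = inv_E` -/

section Invariant

variable (F E : Type u) [Field F] [ValuativeRel F] [TopologicalSpace F] [IsNonarchimedeanLocalField F]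
  [CharZero F] [Field E] [ValuativeRel E] [TopologicalSpace E] [IsNonarchimedeanLocalField E]
  [CharZero E] [Algebra F E] [FiniteDimensional F E]

/-- `ℚ/ℤ` is divisible: `d • u' = u` is solvable for `d ≥ 1`. [folklore] -/
private theorem exists_nsmul_eq_addCircle (d : ℕ) (hd : 0 < d) (u : AddCircle (1 : ℚ)) :
    ∃ u' : AddCircle (1 : ℚ), d • u' = u := by
  induction u using QuotientAddGroup.induction_on with
  | H q =>
    refine ⟨((q / d : ℚ) : AddCircle (1 : ℚ)), ?_⟩
    rw [← AddCircle.coe_nsmul, nsmul_eq_mul, mul_div_cancel₀ _ (Nat.cast_ne_zero.2 hd.ne')]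

/-- **`inv_F ∘ Cor_{E/F} = inv_E` on `H²(·, μ_{ℚ/ℤ})`** (Serre, *Local Fields* XI §2 Prop. 1 (ii), for the
class formation of XIII §4): from `inv_E ∘ Res = [E : F] · inv_F` (`invariantQZEquiv_res`, XIII §3 Prop. 7),
`Cor ∘ Res = [E : F]` (`H2MuQZ.cor_res`) and the divisibility of `ℚ/ℤ` (every class of `E` is a
restriction) — the argument of loc. cit. p. 167 verbatim.
[cite: SerreLocalFields1979, XI §2 Prop. 1 (ii)] -/
theorem invariantQZEquiv_cor (y : H2MuQZ E) :
    invariantQZEquiv F (H2MuQZ.cor F E y) = invariantQZEquiv E y := by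
  obtain ⟨u', hu'⟩ := exists_nsmul_eq_addCircle (Module.finrank F E) Module.finrank_pos (invariantQZEquiv E y)
  have hres : H2MuQZ.res F E ((invariantQZEquiv F).symm u') = y :=
    (invariantQZEquiv E).injective (by rw [invariantQZEquiv_res, AddEquiv.apply_symm_apply, hu'])
  rw [← hres, H2MuQZ.cor_res, map_nsmul, invariantQZEquiv_res, AddEquiv.apply_symm_apply]

/-- **`inv_{F,n} ∘ Cor_{E/F} = inv_{E,n}` on `H²(·, μ_n)`** for THE level residue maps `invLevel`.
[cite: SerreLocalFields1979, XI §2 Prop. 1 (ii)] -/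
theorem invLevel_corMu (n : ℕ) [NeZero n] (y : galoisCohomology (mu E n) 2) :
    invLevel F n (corMu F E n y) = invLevel E n y := by
  have h := invariantQZEquiv_cor F E (H2MuQZ.of ⟨n, NeZero.pos n⟩ y)
  rw [H2MuQZ.cor_of] at h
  change invariantQZ F (H2MuQZ.of ⟨n, NeZero.pos n⟩ (corMu F E n y)) =
    invariantQZ E (H2MuQZ.of ⟨n, NeZero.pos n⟩ y) at h
  rw [invariantQZ_of', invariantQZ_of'] at h
  exact zmodToQmodZ_injective n h

end Invariant

end Prop121vii

end Literature.AnabelianGeometry.AbsoluteAnabelian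

end
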